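import Summits.QuantumAdvantage.AdviceFreeQNC0.BlockLemmaQuant
import Summits.QuantumAdvantage.AdviceFreeQNC0.BondTwistOddSite
import HarnessLib

/-!
# Cell qa-qnc0, `p = 3` — `BlockNormUniform3` at radius `0`: the SHARP single-site constant `(2+√3)/4 = cos²(π/12)`
(planner qa-qnc0-p1 g20, `exp20/Sketch20x.lean` §8 conjecture `BlockNormUniform3`, kit j297011: worst block `.96593 = cos(π/12)`)

**`rnsq_siteOpR_le_sharp`**: for a primitive cube root `ζ` and an ARBITRARY sign pattern `ε σ b` (state AND bit),
`rnsq (siteOpR ζ ε f) ≤ (2+√3)/4 · rnsq f` on `RegState 0`; hence **`blockNormUniform3_zero`** (the `r = 0` case of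
`BlockNormUniform3`, verbatim constant).  Mechanism: the two outputs `(S,0)`, `(S,1)` share their inputs `P, Q`; after absorbing
signs, `‖ζP + αQ‖² + ‖P + ζβQ‖² = 2(‖P‖²+‖Q‖²) + 2Re((αζ + βζ̄)PQ̄)` with `α, β = ±1`, and `|ζ + ζ̄| = 1`, `|ζ − ζ̄| = √3`
(`pair_le_sqrt3`).  With a COMMON sign (`α = β`, fixed bells) the constant is `3/4` (`twAvgX_core`).

WHAT THIS IS NOT: radius `r ≥ 1` (the conjecture proper) is open; crux 22907 untouched; separation NOT moved.
-/

noncomputable section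

namespace Summit.QuantumAdvantage.AdviceFreeQNC0

open Finset

namespace BondTwist3

/-- `‖ζ − ζ̄‖² = 3` for a primitive cube root. -/
theorem normSq_sub_conj_of_cube_root {ζ : ℂ} (hζ3 : ζ ^ 3 = 1) (hζ1 : ζ ≠ 1) :
    ‖ζ - (starRingEnd ℂ) ζ‖ ^ 2 = 3 := by
  have hs := add_conj_of_cube_root hζ3 hζ1
  have hn := normSq_of_cube_root hζ3
  have hre : ζ.re = -1 / 2 := by
    have := congrArg Complex.re hs
    simp only [Complex.add_re, Complex.conj_re, Complex.neg_re, Complex.one_re] at this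
    linarith
  have him : ζ.im ^ 2 = 3 / 4 := by
    rw [Complex.normSq_apply] at hn
    nlinarith
  rw [Complex.sq_norm, Complex.normSq_apply]
  simp only [Complex.sub_re, Complex.conj_re, Complex.sub_im, Complex.conj_im, sub_self]
  nlinarith

/-- `‖αζ + βζ̄‖ ≤ √3` for signs `α, β`. -/
theorem norm_sign_comb_le {ζ : ℂ} (hζ3 : ζ ^ 3 = 1) (hζ1 : ζ ≠ 1) {α β : ℂ} (hα : α = 1 ∨ α = -1) (hβ : β = 1 ∨ β = -1) :
    ‖α * ζ + β * (starRingEnd ℂ) ζ‖ ≤ Real.sqrt 3 := by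
  have hs := add_conj_of_cube_root hζ3 hζ1
  have hd := normSq_sub_conj_of_cube_root hζ3 hζ1
  have h13 : (1 : ℝ) ≤ Real.sqrt 3 := by
    rw [show (1 : ℝ) = Real.sqrt 1 by simp]; exact Real.sqrt_le_sqrt (by norm_num)
  have hsq3 : ‖ζ - (starRingEnd ℂ) ζ‖ = Real.sqrt 3 := by
    rw [← Real.sqrt_sq (norm_nonneg _), hd]
  rcases hα with rfl | rfl <;> rcases hβ with rfl | rfl
  · rw [one_mul, one_mul, hs]; simp [h13]
  · rw [one_mul, neg_one_mul, ← sub_eq_add_neg, hsq3]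
  · rw [neg_one_mul, one_mul, show -ζ + (starRingEnd ℂ) ζ = -(ζ - (starRingEnd ℂ) ζ) by ring, norm_neg, hsq3]
  · rw [neg_one_mul, neg_one_mul, ← neg_add, norm_neg, hs]; simp [h13]

/-- **The sharp pair inequality with independent signs**: `‖ζP + αQ‖² + ‖P + ζβQ‖² ≤ (2+√3)(‖P‖² + ‖Q‖²)`. -/
theorem pair_le_sqrt3 {ζ : ℂ} (hζ3 : ζ ^ 3 = 1) (hζ1 : ζ ≠ 1) (P Q α β : ℂ) (hα : α = 1 ∨ α = -1)
    (hβ : β = 1 ∨ β = -1) :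
    ‖ζ * P + α * Q‖ ^ 2 + ‖P + ζ * β * Q‖ ^ 2 ≤ (2 + Real.sqrt 3) * (‖P‖ ^ 2 + ‖Q‖ ^ 2) := by
  have hn : Complex.normSq ζ = 1 := normSq_of_cube_root hζ3
  have hαn : Complex.normSq α = 1 := by rcases hα with rfl | rfl <;> simp
  have hβn : Complex.normSq β = 1 := by rcases hβ with rfl | rfl <;> simp
  have hαc : (starRingEnd ℂ) α = α := by rcases hα with rfl | rfl <;> simp
  have hβc : (starRingEnd ℂ) β = β := by rcases hβ with rfl | rfl <;> simp
  rw [Complex.sq_norm, Complex.sq_norm, Complex.sq_norm, Complex.sq_norm, Complex.normSq_add, Complex.normSq_add,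
    Complex.normSq_mul, Complex.normSq_mul, Complex.normSq_mul, Complex.normSq_mul, hn, hαn, hβn]
  simp only [one_mul, mul_one]
  have hcross : (ζ * P * (starRingEnd ℂ) (α * Q)).re + (P * (starRingEnd ℂ) (ζ * β * Q)).re =
      ((α * ζ + β * (starRingEnd ℂ) ζ) * (P * (starRingEnd ℂ) Q)).re := by
    rw [map_mul, map_mul, map_mul, hαc, hβc, ← Complex.add_re]; congr 1; ring
  have hre : ((α * ζ + β * (starRingEnd ℂ) ζ) * (P * (starRingEnd ℂ) Q)).re ≤ Real.sqrt 3 * (‖P‖ * ‖Q‖) := by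
    refine (Complex.re_le_norm _).trans ?_
    rw [norm_mul, norm_mul, Complex.norm_conj]
    exact mul_le_mul_of_nonneg_right (norm_sign_comb_le hζ3 hζ1 hα hβ) (by positivity)
  have h2 : 2 * (‖P‖ * ‖Q‖) ≤ ‖P‖ ^ 2 + ‖Q‖ ^ 2 := by nlinarith [sq_nonneg (‖P‖ - ‖Q‖)]
  have hw : (0 : ℝ) ≤ Real.sqrt 3 := Real.sqrt_nonneg _
  rw [Complex.normSq_eq_norm_sq P, Complex.normSq_eq_norm_sq Q] at *
  nlinarith [mul_le_mul_of_nonneg_left h2 hw]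

/-- **Sharp single-site contraction with arbitrary signs** (`RegState 0`): `rnsq (T f) ≤ (2+√3)/4 · rnsq f`. -/
theorem rnsq_siteOpR_le_sharp {ζ : ℂ} (hζ3 : ζ ^ 3 = 1) (hζ1 : ζ ≠ 1) (ε : RegState 0 → Bool → Bool)
    (f : RegState 0 → ℂ) : rnsq (siteOpR ζ ε f) ≤ ((2 + Real.sqrt 3) / 4) * rnsq f := by
  -- sums over `RegState 0 = ZMod 3 × Bool × (Fin 0 → Bool)`
  have hsum : ∀ g : RegState 0 → ℝ, ∑ σ : RegState 0, g σ =
      ∑ S : ZMod 3, (g (S, true, Fin.elim0) + g (S, false, Fin.elim0)) := by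
    intro g
    rw [Fintype.sum_prod_type]
    refine Finset.sum_congr rfl fun S _ => ?_
    rw [Fintype.sum_prod_type, Fintype.sum_bool]
    have he : ∀ e : Fin 0 → Bool, e = Fin.elim0 := fun e => funext fun i => Fin.elim0 i
    rw [Fintype.sum_eq_single (Fin.elim0 : Fin 0 → Bool) (fun e hne => absurd (he e) hne),
      Fintype.sum_eq_single (Fin.elim0 : Fin 0 → Bool) (fun e hne => absurd (he e) hne)]
  have he0 : ∀ (e : Fin 0 → Bool) (b : Bool), shiftIn e b = Fin.elim0 := fun e b => funext fun i => Fin.elim0 i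
  -- the two outputs at position `S`
  have hout : ∀ (S : ZMod 3) (s : Bool), siteOpR ζ ε f (S, s, Fin.elim0) =
      ((if ε (S, s, Fin.elim0) false then (-1 : ℂ) else 1) * f (S + spinZ (!s), !s, Fin.elim0) +
        ζ * (if ε (S, s, Fin.elim0) true then (-1 : ℂ) else 1) * f (S + spinZ s, s, Fin.elim0)) / 2 := by
    intro S s
    simp only [siteOpR, nextState, he0]
    cases s <;> simp
  unfold rnsq
  rw [hsum, hsum (fun σ => ‖f σ‖ ^ 2), Finset.mul_sum]
  -- compare position by position, then re-index the inputs
  have hS : ∀ S : ZMod 3, ‖siteOpR ζ ε f (S, true, Fin.elim0)‖ ^ 2 + ‖siteOpR ζ ε f (S, false, Fin.elim0)‖ ^ 2 ≤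
      ((2 + Real.sqrt 3) / 4) * (‖f (S + 1, true, Fin.elim0)‖ ^ 2 + ‖f (S + 2, false, Fin.elim0)‖ ^ 2) := by
    intro S
    rw [hout S true, hout S false]
    simp only [Bool.not_true, Bool.not_false]
    have s1 : spinZ true = 1 := rfl
    have s2 : spinZ false = -1 := rfl
    have hm1 : (-1 : ZMod 3) = 2 := by decide
    rw [s1, s2, hm1]
    have he1 := sgn_cases (ε (S, true, Fin.elim0) true)
    have he0 := sgn_cases (ε (S, true, Fin.elim0) false)
    have he0' := sgn_cases (ε (S, false, Fin.elim0) false)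
    have he1' := sgn_cases (ε (S, false, Fin.elim0) true)
    generalize (if ε (S, true, Fin.elim0) true then (-1 : ℂ) else 1) = e1 at he1 ⊢
    generalize (if ε (S, true, Fin.elim0) false then (-1 : ℂ) else 1) = e0 at he0 ⊢
    generalize (if ε (S, false, Fin.elim0) false then (-1 : ℂ) else 1) = e0' at he0' ⊢
    generalize (if ε (S, false, Fin.elim0) true then (-1 : ℂ) else 1) = e1' at he1' ⊢
    generalize f (S + 1, true, Fin.elim0) = P
    generalize f (S + 2, false, Fin.elim0) = Q
    have hsq1 : e1 * e1 = 1 := by rcases he1 with rfl | rfl <;> norm_num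
    have hsq0' : e0' * e0' = 1 := by rcases he0' with rfl | rfl <;> norm_num
    -- absorb the signs: `‖e0 Q + ζ e1 P‖ = ‖ζ P + (e0 e1) Q‖`, `‖e0' P + ζ e1' Q‖ = ‖P + ζ (e0' e1') Q‖`
    have n1 : ‖e0 * Q + ζ * e1 * P‖ = ‖ζ * P + e0 * e1 * Q‖ := by
      have h : e1 * (e0 * Q + ζ * e1 * P) = ζ * P + e0 * e1 * Q := by linear_combination (ζ * P) * hsq1
      rw [← h, norm_mul, norm_pm he1, one_mul]
    have n2 : ‖e0' * P + ζ * e1' * Q‖ = ‖P + ζ * (e0' * e1') * Q‖ := by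
      have h : e0' * (e0' * P + ζ * e1' * Q) = P + ζ * (e0' * e1') * Q := by linear_combination P * hsq0'
      rw [← h, norm_mul, norm_pm he0', one_mul]
    rw [norm_div, norm_div, Complex.norm_two, div_pow, div_pow, n1, n2]
    have hp := pair_le_sqrt3 hζ3 hζ1 P Q (e0 * e1) (e0' * e1') (pm_mul he0 he1) (pm_mul he0' he1')
    linarith
  calc ∑ S : ZMod 3, (‖siteOpR ζ ε f (S, true, Fin.elim0)‖ ^ 2 + ‖siteOpR ζ ε f (S, false, Fin.elim0)‖ ^ 2)
      ≤ ∑ S : ZMod 3, ((2 + Real.sqrt 3) / 4) * (‖f (S + 1, true, Fin.elim0)‖ ^ 2 + ‖f (S + 2, false, Fin.elim0)‖ ^ 2) :=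
        Finset.sum_le_sum fun S _ => hS S
    _ = ∑ S : ZMod 3, ((2 + Real.sqrt 3) / 4) * (‖f (S, true, Fin.elim0)‖ ^ 2 + ‖f (S, false, Fin.elim0)‖ ^ 2) := by
        rw [← Finset.mul_sum, ← Finset.mul_sum, Finset.sum_add_distrib, Finset.sum_add_distrib,
          sum_shift 1 (fun S => ‖f (S, true, Fin.elim0)‖ ^ 2), sum_shift 2 (fun S => ‖f (S, false, Fin.elim0)‖ ^ 2)]

/-- **`BlockNormUniform3` at radius `0` — PROVED** (the block is the single twisted site). -/
theorem blockNormUniform3_zero (ζ : ℂ) (hζ3 : ζ ^ 3 = 1) (hζ1 : ζ ≠ 1) (ω : Fin (2 * 0) → ℂ)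
    (ε : Fin (2 * 0 + 1) → RegState 0 → Bool → Bool) (f : RegState 0 → ℂ) :
    rnsq (blockOpR ζ ω ε f) ≤ ((2 + Real.sqrt 3) / 4) * rnsq f := by
  have hnil : (List.ofFn fun j : Fin (2 * 0) => (ω j, ε j.succ)) = [] := List.eq_nil_of_length_eq_zero (by simp)
  rw [blockOpR_eq_chainOp, hnil, chainOp_cons, chainOp_nil]
  exact rnsq_siteOpR_le_sharp hζ3 hζ1 (ε 0) f

end BondTwist3

end Summit.QuantumAdvantage.AdviceFreeQNC0

end
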